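import Mathlib
import HarnessLib
import Literature.Combinatorics.Additive.Pollard
import Literature.Combinatorics.Additive.Kneser
import Literature.Combinatorics.Additive.GrynkiewiczPollardRep
import Literature.Combinatorics.Additive.GrynkiewiczPollardKneserTools
import Literature.Combinatorics.Additive.GrynkiewiczPollardStepOne
import Literature.Combinatorics.Additive.GrynkiewiczPollardStepTwo
import Literature.Combinatorics.Additive.GrynkiewiczPollardDyson
import Literature.Combinatorics.Additive.GrynkiewiczPollardStepThree

/-!
# Grynkiewicz's extension of Pollard's theorem — port, part VII: STEP 3 for `t = 2` (Case 3.1)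

Topic: `Literature/Combinatorics/Additive`.  Seventh file of the port of [Gry10] Theorem 1.1 / 1.2.
Case 3.1 of [Gry10] §2 (the sharp constant `4` of Theorem 1.2): with `t = 2`, if every translate of `B`
not contained in `A` meets `A` in at most one point, then `Goal 2 c A B` for `c ≥ 4`.  Ingredients: the
unpopular-row/column form of STEP 2, `#{w : r(w) = 1} ≤ |B|`, `A = T + B` for `T = {z : z + B ⊆ A}`, a
Sidon property of `B` (`B − B` has unique representations, via `|stab(A)| ≤ 1`), `2|B + B| ≥ |B|² + |B|`,
Proposition 5 for `T + (B + B)`, Cauchy–Schwarz (Lemma 2.1 with `k = t = 1`), and the polynomial endgame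
`case31_arith`.

## References
* D. J. Grynkiewicz, *On extending Pollard's theorem for t-representable sums*, Israel J. Math. 177 (2010)
  413–439 (arXiv:0803.2601), §2 Case 3.1 [cite: Grynkiewicz2010, Thm 1.2].
-/

namespace Literature.Combinatorics.Additive

namespace Grynkiewicz

open Finset Pollard
open scoped Pointwise

variable {G : Type*} [AddCommGroup G] [DecidableEq G]

section StepThreeT2

variable {c : ℕ} {A B : Finset G}

/-- The elementary endgame of Case 3.1, in shifted variables `b = k + 3`, `a = b + m`: the bounds
`2|T| + b² + 3 ≤ 2a + 2b`, `(ab)² ≤ |A+B| · W`, `W + |T|b ≤ |T|b² + ab`, `2|A+B| + 5 ≤ 2a + 3b` are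
contradictory. [cite: Grynkiewicz2010, §2 Case 3.1] -/
theorem case31_arith (k m a b S T W : ℕ) (hb : b = k + 3) (ha : a = b + m)
    (hI : 2 * T + b * b + 3 ≤ 2 * a + 2 * b) (hII : (a * b) * (a * b) ≤ S * W)
    (hW : W + T * b ≤ T * b * b + a * b) (hIII : 2 * S + 5 ≤ 2 * a + 3 * b) : False := by
  subst hb; subst ha
  have X1 : 2 * T + k * (k + 2) ≤ 2 * m := by nlinarith [hI]
  have hS : 2 * S ≤ 2 * m + 5 * k + 10 := by omega
  have X2a : 2 * W ≤ 2 * T * ((k + 3) * (k + 2)) + 2 * ((k + 3 + m) * (k + 3)) := by nlinarith [hW]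
  have X2b : 2 * T * ((k + 3) * (k + 2)) + k * (k + 2) * ((k + 3) * (k + 2)) ≤ 2 * m * ((k + 3) * (k + 2)) := by
    have := Nat.mul_le_mul_right ((k + 3) * (k + 2)) X1; nlinarith [this]
  have X3 : 4 * ((k + 3 + m) * (k + 3)) * ((k + 3 + m) * (k + 3)) ≤ (2 * m + 5 * k + 10) * (2 * W) := by
    have h4 := Nat.mul_le_mul_right (2 * W) hS
    nlinarith [hII, h4]
  have X4 := Nat.mul_le_mul_left (2 * m + 5 * k + 10) (show 2 * W + k * (k + 2) * ((k + 3) * (k + 2)) ≤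
      2 * m * ((k + 3) * (k + 2)) + 2 * ((k + 3 + m) * (k + 3)) by linarith [X2a, X2b])
  have X5 : (2 * m + 5 * k + 10) * (2 * m * ((k + 3) * (k + 2)) + 2 * ((k + 3 + m) * (k + 3))) +
      (k + 3) * (2 * (k + 3 + m) * (k ^ 3 + 3 * k ^ 2 + k) + (3 * k + 4) * (k ^ 2 + 4 * k + 6) * (k + 2)) =
      4 * ((k + 3 + m) * (k + 3)) * ((k + 3 + m) * (k + 3)) +
        (2 * m + 5 * k + 10) * (k * (k + 2) * ((k + 3) * (k + 2))) := by ring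
  have hR : 1 ≤ (k + 3) * (2 * (k + 3 + m) * (k ^ 3 + 3 * k ^ 2 + k) +
      (3 * k + 4) * (k ^ 2 + 4 * k + 6) * (k + 2)) :=
    Nat.one_le_iff_ne_zero.2 (by positivity)
  nlinarith [X3, X4, X5, hR]

/-- Two distinct representations in a fibre give `r ≥ 2`. [cite: Grynkiewicz2010, §2 Case 3.1] -/
theorem two_le_rep_of_ne {A B : Finset G} {a a' b b' : G} (ha : a ∈ A) (hb : b ∈ B) (ha' : a' ∈ A)
    (hb' : b' ∈ B) (he : a + b = a' + b') (hne : (a, b) ≠ (a', b')) : 2 ≤ rep A B (a + b) := by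
  rw [rep_def]
  refine one_lt_card.2 ⟨(a, b), ?_, (a', b'), ?_, hne⟩
  · exact mem_filter.2 ⟨mem_product.2 ⟨ha, hb⟩, rfl⟩
  · exact mem_filter.2 ⟨mem_product.2 ⟨ha', hb'⟩, he.symm⟩

/-- If `r_{A,B}(a + b) ≥ 2` there is a representation other than `(a, b)`. [cite: Grynkiewicz2010, §2 Case 3.1] -/
theorem exists_ne_of_two_le_rep {A B : Finset G} {a b : G} (h : 2 ≤ rep A B (a + b)) :
    ∃ a' ∈ A, ∃ b' ∈ B, a' + b' = a + b ∧ (a', b') ≠ (a, b) := by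
  rw [rep_def] at h
  obtain ⟨p, hp, q, hq, hpq⟩ := one_lt_card.1 h
  rw [mem_filter, mem_product] at hp hq
  by_cases hpa : p = (a, b)
  · refine ⟨q.1, hq.1.1, q.2, hq.1.2, hq.2, fun e => hpq ?_⟩
    rw [hpa, ← e]
  · exact ⟨p.1, hp.1.1, p.2, hp.1.2, hp.2, fun e => hpa (by rw [← e])⟩

/-- **[Gry10] §2 STEP 3, Case 3.1 (`t = 2`).**  Let `4 ≤ c`, `|A| ≥ |B| ≥ 3`, and assume the induction
hypothesis below `(A,B)` (for `t = 2`).  If every translate `z + B` not contained in `A` meets `A` in at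
most one point, then `Goal 2 c A B`. [cite: Grynkiewicz2010, §2 Case 3.1] -/
theorem step_three_t2 (hc : 4 ≤ c) (ih : IH 2 c A B) (hBA : B.card ≤ A.card) (hB : 3 ≤ B.card)
    (hm : ∀ z : G, (A ∩ (z +ᵥ B)).card ≤ 1 ∨ z +ᵥ B ⊆ A) : Goal 2 c A B := by
  have hA : 3 ≤ A.card := hB.trans hBA
  have hAne : A.Nonempty := card_pos.1 (by omega)
  have hBne : B.Nonempty := card_pos.1 (by omega)
  have hm' : ∀ z : G, (A ∩ (z +ᵥ B)).card + 1 ≤ 2 ∨ z +ᵥ B ⊆ A := fun z =>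
    (hm z).imp (fun h => by omega) id
  by_cases hstab : 2 ≤ A.addStab.card
  · exact goal_of_card_addStab_ge (by norm_num) (by omega) ih hA hB hstab
  rw [not_le] at hstab
  -- unpopular rows and columns (STEP 2)
  by_cases hrow : ∃ b ∈ B, 2 ≤ (A.filter (fun a => rep A B (a + b) ≤ 2)).card
  · obtain ⟨b, hb, h⟩ := hrow; exact goal_of_row (by norm_num) (by omega) ih hA hB hb h
  by_cases hcol : ∃ a ∈ A, 2 ≤ (B.filter (fun b => rep A B (a + b) ≤ 2)).card
  · obtain ⟨a, ha, h⟩ := hcol; exact goal_of_col (by norm_num) (by omega) ih hA hB ha h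
  push Not at hrow hcol
  -- Proposition 5: if `|A + B| ≤ |A| + |B| - 2` every sum is `2`-popular
  by_cases hk : (A + B).card + 2 ≤ A.card + B.card
  · exact Or.inr ⟨A, B, Str.of_popular (by norm_num) fun w hw => le_rep_of_card_add_le hk hw⟩
  rw [not_le] at hk
  by_cases hP : 2 * (A.card + B.card) ≤ NS 2 A B + c
  · exact Or.inl hP
  rw [not_le] at hP
  exfalso
  -- `#{w : r(w) = 1} ≤ |B|`
  set E1 := (A + B).filter (fun w => rep A B w = 1) with hE1
  have hE1le : E1.card ≤ B.card := by
    -- pairs with a uniquely represented sum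
    set Q := (A ×ˢ B).filter (fun p => p.1 + p.2 ∈ E1) with hQ
    have hQ1 : Q.card = E1.card := by
      rw [card_eq_sum_card_fiberwise (f := fun p : G × G => p.1 + p.2) (s := Q) (t := E1)
        (fun p hp => mem_coe.2 (mem_filter.1 (mem_coe.1 hp)).2)]
      rw [card_eq_sum_ones E1]
      refine sum_congr rfl fun w hw => ?_
      have hr : rep A B w = 1 := (mem_filter.1 hw).2
      rw [← hr, rep_def]
      congr 1
      ext p
      simp only [hQ, mem_filter, mem_product]
      constructor
      · rintro ⟨⟨hp, _⟩, he⟩; exact ⟨hp, he⟩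
      · rintro ⟨hp, he⟩; exact ⟨⟨hp, by rw [he]; exact hw⟩, he⟩
    have hQ2 : Q.card ≤ B.card := by
      rw [card_eq_sum_card_fiberwise (f := fun p : G × G => p.2) (s := Q) (t := B)
        (fun p hp => mem_coe.2 (mem_product.1 (mem_filter.1 (mem_coe.1 hp)).1).2)]
      rw [card_eq_sum_ones B]
      refine sum_le_sum fun b hb => ?_
      refine le_trans ?_ (Nat.lt_succ_iff.1 (hrow b hb))
      have hinj : Set.InjOn (fun p : G × G => p.1) ↑(Q.filter (fun p => p.2 = b)) := by
        rintro ⟨a1, b1⟩ h1 ⟨a2, b2⟩ h2 (e : a1 = a2)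
        have h1' := (mem_filter.1 (mem_coe.1 h1)).2
        have h2' := (mem_filter.1 (mem_coe.1 h2)).2
        simp only at h1' h2'
        rw [e, h1', h2']
      rw [← card_image_of_injOn hinj]
      refine card_le_card fun a ha => ?_
      obtain ⟨⟨a', b'⟩, hp, rfl⟩ := mem_image.1 ha
      rw [mem_filter, hQ, mem_filter, mem_product] at hp
      obtain ⟨⟨⟨ha', -⟩, hE⟩, hb'⟩ := hp
      simp only at hb' ⊢
      rw [mem_filter]
      refine ⟨ha', ?_⟩
      rw [hb'] at hE
      rw [(mem_filter.1 hE).2]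
      norm_num
    omega
  -- `N_2 + #E1 = 2 |A + B|`
  have hNSE : NS 2 A B + E1.card = 2 * (A + B).card := by
    rw [NS_eq_split]
    have h1 : (A + B).filter (fun w => rep A B w < 2) = E1 := by
      refine filter_congr fun w hw => ?_
      have := one_le_rep_of_mem hw
      omega
    have h2 : ∑ w ∈ (A + B).filter (fun w => rep A B w < 2), rep A B w = E1.card := by
      rw [h1, card_eq_sum_ones]
      exact sum_congr rfl fun w hw => (mem_filter.1 hw).2
    have h3 := card_filter_add_card_filter_not (s := A + B) (fun w => 2 ≤ rep A B w)
    have h4 : (A + B).filter (fun w => ¬ 2 ≤ rep A B w) = E1 := by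
      rw [← h1]; exact filter_congr fun w _ => not_le
    rw [h4] at h3
    rw [h2]
    omega
  have hIII : 2 * (A + B).card + 5 ≤ 2 * A.card + 3 * B.card := by omega
  -- `A = T + B`
  set T := (A - B).filter (fun z => z +ᵥ B ⊆ A) with hTdef
  have hTB : T + B ⊆ A := translates_add_subset
  have hAT : A ⊆ T + B := by
    intro a ha
    by_contra haT
    -- every `a + b` is uniquely represented
    have hall : ∀ b ∈ B, rep A B (a + b) ≤ 2 := by
      intro b hb
      by_contra h2
      rw [not_le] at h2
      obtain ⟨a', ha', b', hb', he, hne⟩ := exists_ne_of_two_le_rep h2.le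
      have hne' : a' ≠ a := by
        rintro rfl
        exact hne (Prod.ext rfl (add_left_cancel he))
      -- the translate `(a - b') + B` contains `a` and `a'`
      rcases hm (a - b') with h | h
      · have h2 : 2 ≤ (A ∩ ((a - b') +ᵥ B)).card := by
          refine one_lt_card.2 ⟨a, ?_, a', ?_, hne'.symm⟩
          · rw [mem_inter_vadd_iff]; exact ⟨ha, by rw [sub_sub_cancel]; exact hb'⟩
          · rw [mem_inter_vadd_iff]
            refine ⟨ha', ?_⟩
            have : a' - (a - b') = b := by rw [eq_sub_of_add_eq he]; abel
            rw [this]; exact hb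
        omega
      · exact haT (mem_add.2 ⟨a - b', (mem_translates_iff hBne).2 h, b', hb', by abel⟩)
    have : B.filter (fun b => rep A B (a + b) ≤ 2) = B := filter_true_of_mem hall
    have h3 := hcol a ha
    rw [this] at h3
    omega
  have hTBA : T + B = A := Subset.antisymm hTB hAT
  have hTne : T.Nonempty := by
    by_contra h
    rw [not_nonempty_iff_eq_empty] at h
    rw [h, empty_add] at hTBA
    exact hAne.ne_empty hTBA.symm
  -- `stab(A) = {0}`
  have hstab0 : ∀ y ∈ A.addStab, y = 0 := by
    intro y hy
    have h0 : (0 : G) ∈ A.addStab := zero_mem_addStab' hAne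
    by_contra hne
    have : 2 ≤ A.addStab.card := one_lt_card.2 ⟨y, hy, 0, h0, hne⟩
    omega
  -- Sidon property of `B`
  have hSidon : ∀ b₁ ∈ B, ∀ b₂ ∈ B, ∀ b₁' ∈ B, ∀ b₂' ∈ B,
      b₁ - b₂ = b₁' - b₂' → b₁ ≠ b₁' → b₁ = b₂ := by
    intro b₁ hb₁ b₂ hb₂ b₁' hb₁' b₂' hb₂' he hne
    have hy : b₁ - b₂ ∈ A.addStab := by
      rw [← hTBA]
      refine addStab_subset_addStab_add hBne (mem_addStab_of_forall_add_mem hTne fun z hz => ?_)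
      rw [mem_translates_iff hBne]
      rcases hm (b₁ - b₂ + z) with h | h
      · exfalso
        have h2 : 2 ≤ (A ∩ ((b₁ - b₂ + z) +ᵥ B)).card := by
          refine one_lt_card.2 ⟨z + b₁, ?_, z + b₁', ?_, fun e => hne (add_left_cancel e)⟩
          · rw [mem_inter_vadd_iff]
            refine ⟨hTB (add_mem_add hz hb₁), ?_⟩
            rw [show z + b₁ - (b₁ - b₂ + z) = b₂ by abel]; exact hb₂
          · rw [mem_inter_vadd_iff]
            refine ⟨hTB (add_mem_add hz hb₁'), ?_⟩
            rw [he, show z + b₁' - (b₁' - b₂' + z) = b₂' by abel]; exact hb₂'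
        omega
      · exact h
    exact sub_eq_zero.1 (hstab0 _ hy)
  -- `2 |B + B| ≥ |B|² + |B|`
  have hBB : B.card * B.card + B.card ≤ 2 * (B + B).card := by
    have hsum : ∑ w ∈ B + B, rep B B w = B.card * B.card := sum_rep_of_subset (Subset.refl _)
    set Dg := B.image (fun x => x + x) with hDg
    have hDgsub : Dg ⊆ B + B := fun w hw => by
      obtain ⟨x, hx, rfl⟩ := mem_image.1 hw; exact add_mem_add hx hx
    have hDgcard : Dg.card = B.card := by
      refine card_image_of_injOn fun x hx x' hx' (e : x + x = x' + x') => ?_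
      by_contra hne
      have h1 : x - x' = x' - x := by
        rw [sub_eq_sub_iff_add_eq_add, e]
      exact hne (hSidon x hx x' hx' x' hx' x hx h1 hne)
    -- `r_{B,B} ≤ 2` everywhere and `= 1` on the diagonal
    have hrep2 : ∀ w ∈ B + B, rep B B w ≤ 2 := by
      intro w hw
      obtain ⟨b₁, hb₁, b₂, hb₂, rfl⟩ := mem_add.1 hw
      rw [rep_def]
      refine (card_le_card (fun p hp => ?_ : _ ⊆ ({(b₁, b₂), (b₂, b₁)} : Finset (G × G)))).trans
        (card_insert_le _ _ |>.trans (by rw [card_singleton]))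
      rw [mem_filter, mem_product] at hp
      rw [mem_insert, mem_singleton]
      by_cases h1 : p.1 = b₁
      · left
        refine Prod.ext h1 ?_
        have := hp.2; rw [h1] at this; exact add_left_cancel this
      · right
        have hd : p.1 - b₂ = b₁ - p.2 := by rw [sub_eq_sub_iff_add_eq_add, hp.2]
        have h3 := hSidon p.1 hp.1.1 b₂ hb₂ b₁ hb₁ p.2 hp.1.2 hd h1
        refine Prod.ext h3 ?_
        have := hp.2; rw [h3, add_comm] at this; exact add_right_cancel this
    have hrep1 : ∀ w ∈ Dg, rep B B w = 1 := by
      intro w hw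
      obtain ⟨x, hx, rfl⟩ := mem_image.1 hw
      refine le_antisymm ?_ (one_le_rep_add hx hx)
      rw [rep_def]
      refine (card_le_card (fun p hp => ?_ : _ ⊆ ({(x, x)} : Finset (G × G)))).trans (by rw [card_singleton])
      rw [mem_filter, mem_product] at hp
      rw [mem_singleton]
      by_cases h1 : p.1 = x
      · refine Prod.ext h1 ?_
        have := hp.2; rw [h1] at this; exact add_left_cancel this
      · exfalso
        have hd : p.1 - x = x - p.2 := by rw [sub_eq_sub_iff_add_eq_add, hp.2]
        have h3 := hSidon p.1 hp.1.1 x hx x hx p.2 hp.1.2 hd h1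
        exact h1 h3
    have hsplit := sum_filter_add_sum_filter_not (B + B) (fun w => w ∈ Dg) (fun w => rep B B w)
    rw [hsum, filter_mem_eq_inter, inter_eq_right.2 hDgsub] at hsplit
    have h1 : ∑ w ∈ Dg, rep B B w = Dg.card := by
      rw [card_eq_sum_ones]; exact sum_congr rfl hrep1
    have h2 : ∑ w ∈ (B + B).filter (fun w => w ∉ Dg), rep B B w ≤ 2 * ((B + B).filter (fun w => w ∉ Dg)).card := by
      rw [mul_comm, card_eq_sum_ones, sum_mul]
      exact sum_le_sum fun w hw => by rw [one_mul]; exact hrep2 w (mem_filter.1 hw).1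
    have h3 : ((B + B).filter (fun w => w ∉ Dg)).card + Dg.card = (B + B).card := by
      have := card_filter_add_card_filter_not (s := B + B) (fun w => w ∈ Dg)
      rw [filter_mem_eq_inter, inter_eq_right.2 hDgsub] at this
      omega
    omega
  -- Proposition 5 for `T + (B + B)`
  have hTBB : T + (B + B) = A + B := by rw [← add_assoc, hTBA]
  by_cases hK : (T + (B + B)).card + 2 ≤ T.card + (B + B).card
  · -- every element of `A + B` has two representations: contradiction with `hP`/structure
    have hpop : ∀ w ∈ A + B, 2 ≤ rep A B w := by
      intro w hw
      rw [← hTBB] at hw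
      have h2 := le_rep_of_card_add_le hK hw
      obtain ⟨z, hz, s, hs, rfl⟩ := mem_add.1 hw
      obtain ⟨z', hz', s', hs', he, hne⟩ := exists_ne_of_two_le_rep h2
      obtain ⟨b₁, hb₁, b₂, hb₂, rfl⟩ := mem_add.1 hs
      obtain ⟨b₁', hb₁', b₂', hb₂', rfl⟩ := mem_add.1 hs'
      have hzA : ∀ z ∈ T, ∀ b ∈ B, z + b ∈ A := fun z hz b hb => hTB (add_mem_add hz hb)
      by_cases h12 : b₁ = b₂
      · by_cases h12' : b₁' = b₂'
        · -- both diagonal: `(z + b₁, b₁)` and `(z' + b₁', b₁')`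
          subst h12; subst h12'
          have e : z + b₁ + b₁ = z' + b₁' + b₁' := by rw [add_assoc, add_assoc, he]
          have h3 := two_le_rep_of_ne (hzA z hz b₁ hb₁) hb₁ (hzA z' hz' b₁' hb₁') hb₁' e (by
            intro hpq
            have hb : b₁ = b₁' := (Prod.mk.inj hpq).2
            have hzz : z = z' := by
              have h1 := (Prod.mk.inj hpq).1
              rw [hb] at h1
              exact add_right_cancel h1
            exact hne (by rw [← hzz, ← hb]))
          rwa [add_assoc] at h3
        · -- `s'` off-diagonal: `(z' + b₁', b₂')` and `(z' + b₂', b₁')`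
          have e : z' + b₁' + b₂' = z' + b₂' + b₁' := by abel
          have h3 := two_le_rep_of_ne (hzA z' hz' b₁' hb₁') hb₂' (hzA z' hz' b₂' hb₂') hb₁' e
            (fun hpq => h12' ((Prod.mk.inj hpq).2).symm)
          rw [add_assoc, he] at h3
          exact h3
      · -- `s` off-diagonal: `(z + b₁, b₂)` and `(z + b₂, b₁)`
        have e : z + b₁ + b₂ = z + b₂ + b₁ := by abel
        have h3 := two_le_rep_of_ne (hzA z hz b₁ hb₁) hb₂ (hzA z hz b₂ hb₂) hb₁ e
          (fun hpq => h12 ((Prod.mk.inj hpq).2).symm)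
        rwa [add_assoc] at h3
    have := NS_eq_mul_card_add_of_popular hpop
    omega
  rw [not_le] at hK
  rw [hTBB] at hK
  have hI : 2 * T.card + B.card * B.card + 3 ≤ 2 * A.card + 2 * B.card := by omega
  -- Cauchy–Schwarz and the energy bound with `t = 2`
  have hCS := sq_sum_le_card_mul_sum_sq (s := A + B) (f := fun w => rep A B w)
  rw [sum_rep_of_subset (Subset.refl _), sq] at hCS
  have hW := sum_rep_sq_le (t := 2) (by norm_num) hm'
  rw [← hTdef] at hW
  simp only [show (2 : ℕ) - 1 = 1 from rfl, one_mul] at hW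
  obtain ⟨k, hk⟩ : ∃ k, B.card = k + 3 := ⟨B.card - 3, by omega⟩
  obtain ⟨m, hm''⟩ : ∃ m, A.card = B.card + m := ⟨A.card - B.card, by omega⟩
  exact case31_arith k m A.card B.card (A + B).card T.card _ hk hm'' hI hCS hW hIII

end StepThreeT2

end Grynkiewicz

end Literature.Combinatorics.Additive
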